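import Mathlib
import Literature.Analysis.FluidPDE.VectorCalculus
import Summits.NavierStokesRegularity.NavierStokesRegularity.Theorems.PlaneEnergyCeilingSlabEnergyIdentitySlab
import Summits.NavierStokesRegularity.NavierStokesRegularity.Theorems.PlaneEnergyCeilingSlabEnergyIdentityPointwise
import Summits.NavierStokesRegularity.NavierStokesRegularity.Theorems.PlaneEnergyCeilingPlanarEnergyAPrioriStrainExcessPointwise
import Summits.NavierStokesRegularity.NavierStokesRegularity.Theorems.PlaneEnergyCeilingPlanarEnergyAPrioriStrainExcessBounds

/-!
# Route PlaneEnergyCeiling · crux `PlanarEnergyAPriori` — the half-space strain-excess identity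

Helper file for the crux item stmt-NavierStokesRegularity-16855 (`PlanarEnergyAPriori`, route
`PlaneEnergyCeiling`), landed `--supports` that item. It proves the kinematic identity
`HalfSpaceStrainExcessIdentity` of the crux idea `gradient-trace-coulomb`
(`Cruxes/PlanarEnergyAPriori/Ideas/gradient-trace-coulomb.md`): for a `C²` divergence-free field
`u` on `ℝ³` with rapid decay and every height `c`,

`∫_{x₂ = c} u₂² dA = ∫_{x₂ > c} σ(x) (x₂ − c) dx`, `σ = Σᵢⱼ ∂ᵢuⱼ ∂ⱼuᵢ` (`= |S|² − ½|ω|² = −Δp`):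

the NORMAL-JET part of the planar energy is the first moment, over the half-space beyond the plane,
of the strain–enstrophy imbalance (the pressure source). In particular `∫_{x₂>c} σ (x₂ − c) ≥ 0`
on every half-space (`setIntegral_halfSpace_strainExcess_moment_nonneg`).

Proof: the divergence theorem on the slab `{c < x₂ < b}` (`sum_setIntegral_slab_fderiv`) for the
two divergence forms of the pointwise companion file — `Σⱼ ∂ⱼ[(x₂−c)((u·∇)u)ⱼ] = ((u·∇)u)₂ +
(x₂−c)σ` and `Σⱼ ∂ⱼ(uⱼu₂) = ((u·∇)u)₂` — gives
`∫_{c<x₂<b} (x₂−c)σ = ∫_{x₂=c}u₂² − ∫_{x₂=b}u₂² + (b−c)∫_{x₂=b}((u·∇)u)₂`, and `b → ∞`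
(monotone convergence of the slab integrals; plane integrals of densities `O((1+|x|)⁻⁶)` are
`O((1+|b|)⁻²)`). Folklore.
-/

noncomputable section

-- single-conjunct summit: `Summit.<Summit>.<Problem>` repeats the name by the D-0017 layout
set_option linter.dupNamespace false

namespace Summit.NavierStokesRegularity.NavierStokesRegularity.Theorems.PlanarEnergyAPriori

open MeasureTheory Set Filter Topology WithLp
open scoped RealInnerProductSpace
open Literature.Analysis.FluidPDE
open Summit.NavierStokesRegularity.NavierStokesRegularity.Theorems.PlaneEnergyCeilingSlabEnergyIdentity

/-! ### The identity on slabs -/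

section Slab

variable {u : EuclideanSpace ℝ (Fin 3) → EuclideanSpace ℝ (Fin 3)} {C : ℝ}

/-- The strain-excess density `σ = Σᵢⱼ ∂ᵢuⱼ ∂ⱼuᵢ` of a `C¹` field is continuous. -/
theorem continuous_strainExcess (hu : ContDiff ℝ 1 u) :
    Continuous fun x => ∑ i : Fin 3, ∑ j : Fin 3,
      fderiv ℝ u x (EuclideanSpace.single i 1) j * fderiv ℝ u x (EuclideanSpace.single j 1) i := by
  have hDc : Continuous (fderiv ℝ u) := hu.continuous_fderiv one_ne_zero
  have hcoord : ∀ i j : Fin 3, Continuous fun x => fderiv ℝ u x (EuclideanSpace.single i 1) j := fun i j =>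
    (EuclideanSpace.proj j).continuous.comp (hDc.clm_apply continuous_const)
  exact continuous_finsetSum _ fun i _ => continuous_finsetSum _ fun j _ => (hcoord i j).mul (hcoord j i)

/-- **The identity on the slab `{c < x₂ < b}`.** For a `C²` divergence-free field with
`‖u‖, ‖Du‖, ‖D²u‖ ≤ C(1 + ‖x‖)⁻⁷`:
`∫_{c<x₂<b} (x₂ − c) σ = ∫_{x₂=c} u₂² − ∫_{x₂=b} u₂² + (b − c) ∫_{x₂=b} ((u·∇)u)₂`. -/
theorem setIntegral_slab_weight_strainExcess (hu : ContDiff ℝ 2 u) (hdiv : VectorCalculus.IsDivFree u)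
    (hC : 1 ≤ C) (h0 : ∀ x, ‖u x‖ ≤ C * (1 + ‖x‖) ^ (-(7 : ℝ)))
    (h1 : ∀ x, ‖fderiv ℝ u x‖ ≤ C * (1 + ‖x‖) ^ (-(7 : ℝ)))
    (h2 : ∀ x, ‖iteratedFDeriv ℝ 2 u x‖ ≤ C * (1 + ‖x‖) ^ (-(7 : ℝ))) {c b : ℝ} (hcb : c ≤ b) :
    ∫ x in {x : EuclideanSpace ℝ (Fin 3) | c < x 2 ∧ x 2 < b}, (x 2 - c) * ∑ i : Fin 3, ∑ j : Fin 3,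
        fderiv ℝ u x (EuclideanSpace.single i 1) j * fderiv ℝ u x (EuclideanSpace.single j 1) i =
      (∫ y : EuclideanSpace ℝ (Fin 2), (u (toLp 2 ![y 0, y 1, c]) 2) ^ 2) -
        (∫ y : EuclideanSpace ℝ (Fin 2), (u (toLp 2 ![y 0, y 1, b]) 2) ^ 2) +
        (b - c) * ∫ y : EuclideanSpace ℝ (Fin 2), convect u u (toLp 2 ![y 0, y 1, b]) 2 := by
  have hC0 : 0 ≤ C := by linarith
  have hu1 : ContDiff ℝ 1 u := hu.of_le one_le_two
  have hud : Differentiable ℝ u := hu.differentiable two_ne_zero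
  set S : Set (EuclideanSpace ℝ (Fin 3)) := {x | c < x 2 ∧ x 2 < b} with hS
  -- ## integrability of the densities
  have hφc : ∀ j : Fin 3, Continuous fun x : EuclideanSpace ℝ (Fin 3) => (x 2 - c) * convect u u x j := fun j =>
    (contDiff_one_weight_mul_convect hu c j).continuous
  have hφ'c : ∀ j : Fin 3, Continuous fun x => fderiv ℝ (fun y : EuclideanSpace ℝ (Fin 3) => (y 2 - c) * convect u u y j)
      x (EuclideanSpace.single j 1) := fun j =>
    ((contDiff_one_weight_mul_convect hu c j).continuous_fderiv one_ne_zero).clm_apply continuous_const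
  have hψc : ∀ j : Fin 3, Continuous fun x => u x j * u x 2 := fun j => (contDiff_one_apply_mul_apply hu1 j).continuous
  have hψ'c : ∀ j : Fin 3, Continuous fun x => fderiv ℝ (fun y => u y j * u y 2) x (EuclideanSpace.single j 1) :=
    fun j => ((contDiff_one_apply_mul_apply hu1 j).continuous_fderiv one_ne_zero).clm_apply continuous_const
  have hIφ : ∀ j : Fin 3, Integrable fun x : EuclideanSpace ℝ (Fin 3) => (x 2 - c) * convect u u x j := fun j =>
    integrable_of_norm_le_weight6 (hφc j) (by positivity) (fun x => norm_weight_mul_convect_le hC h0 h1 c x j)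
  have hIφ' : ∀ j : Fin 3, Integrable fun x => fderiv ℝ (fun y : EuclideanSpace ℝ (Fin 3) => (y 2 - c) * convect u u y j)
      x (EuclideanSpace.single j 1) := fun j =>
    integrable_of_norm_le_weight6 (hφ'c j) (by positivity) (fun x => norm_fderiv_weight_mul_convect_le hC h0 h1 h2 hu c x j)
  have hIψ : ∀ j : Fin 3, Integrable fun x => u x j * u x 2 := fun j =>
    integrable_of_norm_le_weight6 (hψc j) (by positivity) (fun x => norm_apply_mul_apply_le hC h0 x j)
  have hIψ' : ∀ j : Fin 3, Integrable fun x => fderiv ℝ (fun y => u y j * u y 2) x (EuclideanSpace.single j 1) :=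
    fun j => integrable_of_norm_le_weight6 (hψ'c j) (by positivity) (fun x => norm_fderiv_apply_mul_apply_le hC h0 h1 hud x j)
  have hSφ : ∀ s : ℝ, Integrable fun y : EuclideanSpace ℝ (Fin 2) =>
      ((toLp 2 ![y 0, y 1, s] : EuclideanSpace ℝ (Fin 3)) 2 - c) * convect u u (toLp 2 ![y 0, y 1, s]) 2 := fun s =>
    integrable_slice_of_norm_le_weight6 (hφc 2) (by positivity) (fun x => norm_weight_mul_convect_le hC h0 h1 c x 2) s
  have hSψ : ∀ s : ℝ, Integrable fun y : EuclideanSpace ℝ (Fin 2) =>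
      u (toLp 2 ![y 0, y 1, s]) 2 * u (toLp 2 ![y 0, y 1, s]) 2 := fun s =>
    integrable_slice_of_norm_le_weight6 (hψc 2) (by positivity) (fun x => norm_apply_mul_apply_le hC h0 x 2) s
  have hIconv : Integrable fun x => convect u u x 2 :=
    integrable_of_norm_le_weight6 ((EuclideanSpace.proj (2 : Fin 3)).continuous.comp (contDiff_one_convect hu).continuous)
      (by positivity) (fun x => ((norm_apply_le_norm _ 2).trans (norm_convect_le hC h0 h1 x)).trans
        (mul_le_mul_of_nonneg_left (rpow_neg_le_rpow_neg_of_le x (show (6 : ℝ) ≤ 7 by norm_num)) (by positivity)))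
  have hIf : Integrable fun x : EuclideanSpace ℝ (Fin 3) => (x 2 - c) * ∑ i : Fin 3, ∑ j : Fin 3,
      fderiv ℝ u x (EuclideanSpace.single i 1) j * fderiv ℝ u x (EuclideanSpace.single j 1) i :=
    integrable_of_norm_le_weight6 ((((EuclideanSpace.proj (2 : Fin 3)).continuous).sub continuous_const).mul
      (continuous_strainExcess hu1)) (by positivity) (fun x => norm_weight_mul_strainExcess_le hC h1 c x)
  -- ## the boundary slices of the weighted flux
  have hc0 : (∫ y : EuclideanSpace ℝ (Fin 2), ((toLp 2 ![y 0, y 1, c] : EuclideanSpace ℝ (Fin 3)) 2 - c) *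
      convect u u (toLp 2 ![y 0, y 1, c]) 2) = 0 := by
    have h : ∀ y : EuclideanSpace ℝ (Fin 2), ((toLp 2 ![y 0, y 1, c] : EuclideanSpace ℝ (Fin 3)) 2 - c) *
        convect u u (toLp 2 ![y 0, y 1, c]) 2 = 0 := fun y => by
      rw [toLp_vec3_apply_two, sub_self, zero_mul]
    simp_rw [h, integral_zero]
  have hb1 : (∫ y : EuclideanSpace ℝ (Fin 2), ((toLp 2 ![y 0, y 1, b] : EuclideanSpace ℝ (Fin 3)) 2 - c) *
      convect u u (toLp 2 ![y 0, y 1, b]) 2) =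
      (b - c) * ∫ y : EuclideanSpace ℝ (Fin 2), convect u u (toLp 2 ![y 0, y 1, b]) 2 := by
    have h : ∀ y : EuclideanSpace ℝ (Fin 2), ((toLp 2 ![y 0, y 1, b] : EuclideanSpace ℝ (Fin 3)) 2 - c) *
        convect u u (toLp 2 ![y 0, y 1, b]) 2 = (b - c) * convect u u (toLp 2 ![y 0, y 1, b]) 2 := fun y => by
      rw [toLp_vec3_apply_two]
    simp_rw [h]
    exact integral_const_mul _ _
  -- ## (I) the divergence theorem for the weighted convective flux
  have hdivφ := sum_setIntegral_slab_fderiv (φ := fun j x => (x 2 - c) * convect u u x j)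
    (fun j => contDiff_one_weight_mul_convect hu c j) hIφ hIφ' hcb (hSφ c) (hSφ b)
  beta_reduce at hdivφ
  rw [hc0, hb1, sub_zero, ← integral_finsetSum _ (fun j _ => (hIφ' j).integrableOn)] at hdivφ
  simp_rw [sum_fderiv_weight_mul_convect hu hdiv c] at hdivφ
  rw [integral_add hIconv.integrableOn hIf.integrableOn] at hdivφ
  -- ## (II) the divergence theorem for the momentum flux
  have hdivψ := sum_setIntegral_slab_fderiv (φ := fun j x => u x j * u x 2)
    (fun j => contDiff_one_apply_mul_apply hu1 j) hIψ hIψ' hcb (hSψ c) (hSψ b)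
  beta_reduce at hdivψ
  rw [← integral_finsetSum _ (fun j _ => (hIψ' j).integrableOn)] at hdivψ
  simp_rw [sum_fderiv_apply_mul_apply_two hud hdiv] at hdivψ
  -- ## combine
  simp_rw [sq]
  linarith

end Slab

/-! ### The half-space identity -/

section HalfSpace

variable {u : EuclideanSpace ℝ (Fin 3) → EuclideanSpace ℝ (Fin 3)} {C : ℝ}

/-- The slabs `{c < x₂ < b}` exhaust the half-space `{c < x₂}`. -/
theorem iUnion_slab_eq_halfSpace (c : ℝ) :
    (⋃ b : ℝ, {x : EuclideanSpace ℝ (Fin 3) | c < x 2 ∧ x 2 < b}) = {x | c < x 2} := by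
  ext x
  simp only [mem_iUnion, mem_setOf_eq]
  exact ⟨fun ⟨_, h⟩ => h.1, fun h => ⟨x 2 + 1, h, by linarith⟩⟩

/-- **THE HALF-SPACE STRAIN-EXCESS IDENTITY** (decay form). For a `C²` divergence-free field
`u` on `ℝ³` with `‖u‖, ‖Du‖, ‖D²u‖ ≤ C(1 + ‖x‖)⁻⁷` and every height `c`:
`∫_{x₂=c} u₂² dA = ∫_{x₂>c} σ(x) (x₂ − c) dx`, `σ = Σᵢⱼ ∂ᵢuⱼ ∂ⱼuᵢ`. -/
theorem integral_plane_sq_apply_two_eq (hu : ContDiff ℝ 2 u) (hdiv : VectorCalculus.IsDivFree u)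
    (hC : 1 ≤ C) (h0 : ∀ x, ‖u x‖ ≤ C * (1 + ‖x‖) ^ (-(7 : ℝ)))
    (h1 : ∀ x, ‖fderiv ℝ u x‖ ≤ C * (1 + ‖x‖) ^ (-(7 : ℝ)))
    (h2 : ∀ x, ‖iteratedFDeriv ℝ 2 u x‖ ≤ C * (1 + ‖x‖) ^ (-(7 : ℝ))) (c : ℝ) :
    ∫ y : EuclideanSpace ℝ (Fin 2), (u (toLp 2 ![y 0, y 1, c]) 2) ^ 2 =
      ∫ x in {x : EuclideanSpace ℝ (Fin 3) | c < x 2}, (∑ i : Fin 3, ∑ j : Fin 3,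
        fderiv ℝ u x (EuclideanSpace.single i 1) j * fderiv ℝ u x (EuclideanSpace.single j 1) i) * (x 2 - c) := by
  have hC0 : 0 ≤ C := by linarith
  have hu1 : ContDiff ℝ 1 u := hu.of_le one_le_two
  set f : EuclideanSpace ℝ (Fin 3) → ℝ := fun x => (x 2 - c) * ∑ i : Fin 3, ∑ j : Fin 3,
      fderiv ℝ u x (EuclideanSpace.single i 1) j * fderiv ℝ u x (EuclideanSpace.single j 1) i with hf
  have hIf : Integrable f :=
    integrable_of_norm_le_weight6 ((((EuclideanSpace.proj (2 : Fin 3)).continuous).sub continuous_const).mul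
      (continuous_strainExcess hu1)) (by positivity) (fun x => norm_weight_mul_strainExcess_le hC h1 c x)
  -- monotone convergence of the slab integrals to the half-space integral
  have hmono : Monotone fun b : ℝ => {x : EuclideanSpace ℝ (Fin 3) | c < x 2 ∧ x 2 < b} :=
    fun b b' hbb' x hx => ⟨hx.1, hx.2.trans_le hbb'⟩
  have hlim1 : Tendsto (fun b : ℝ => ∫ x in {x : EuclideanSpace ℝ (Fin 3) | c < x 2 ∧ x 2 < b}, f x) atTop
      (𝓝 (∫ x in {x : EuclideanSpace ℝ (Fin 3) | c < x 2}, f x)) := by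
    have h := tendsto_setIntegral_of_monotone (μ := volume) (fun b => measurableSet_slab c b) hmono
      (by rw [iUnion_slab_eq_halfSpace]; exact hIf.integrableOn)
    rwa [iUnion_slab_eq_halfSpace] at h
  -- the same integrals through the slab identity
  have hA : Tendsto (fun b : ℝ => ∫ y : EuclideanSpace ℝ (Fin 2), (u (toLp 2 ![y 0, y 1, b]) 2) ^ 2) atTop (𝓝 0) := by
    exact tendsto_integral_plane_zero (g := fun x => (u x 2) ^ 2) (by positivity : (0 : ℝ) ≤ C ^ 2)
      (fun x => by rw [sq]; exact norm_apply_mul_apply_le hC h0 x 2)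
  have hΦ : Tendsto (fun b : ℝ => (b - c) * ∫ y : EuclideanSpace ℝ (Fin 2), convect u u (toLp 2 ![y 0, y 1, b]) 2)
      atTop (𝓝 0) :=
    tendsto_sub_mul_integral_plane_zero (g := fun x => convect u u x 2)
      (by positivity : (0 : ℝ) ≤ C ^ 2)
      (fun x => ((norm_apply_le_norm _ 2).trans (norm_convect_le hC h0 h1 x)).trans
        (mul_le_mul_of_nonneg_left (rpow_neg_le_rpow_neg_of_le x (show (6 : ℝ) ≤ 7 by norm_num)) (by positivity))) c
  have hlim2 : Tendsto (fun b : ℝ => ∫ x in {x : EuclideanSpace ℝ (Fin 3) | c < x 2 ∧ x 2 < b}, f x) atTop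
      (𝓝 (∫ y : EuclideanSpace ℝ (Fin 2), (u (toLp 2 ![y 0, y 1, c]) 2) ^ 2)) := by
    have hev : ∀ᶠ b in atTop,
        (∫ y : EuclideanSpace ℝ (Fin 2), (u (toLp 2 ![y 0, y 1, c]) 2) ^ 2) -
          (∫ y : EuclideanSpace ℝ (Fin 2), (u (toLp 2 ![y 0, y 1, b]) 2) ^ 2) +
          (b - c) * (∫ y : EuclideanSpace ℝ (Fin 2), convect u u (toLp 2 ![y 0, y 1, b]) 2) =
        ∫ x in {x : EuclideanSpace ℝ (Fin 3) | c < x 2 ∧ x 2 < b}, f x := by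
      filter_upwards [eventually_ge_atTop c] with b hb
      exact (setIntegral_slab_weight_strainExcess hu hdiv hC h0 h1 h2 hb).symm
    refine Tendsto.congr' hev ?_
    have h := ((tendsto_const_nhds
      (x := ∫ y : EuclideanSpace ℝ (Fin 2), (u (toLp 2 ![y 0, y 1, c]) 2) ^ 2)).sub hA).add hΦ
    simpa using h
  have heq := tendsto_nhds_unique hlim2 hlim1
  rw [heq, hf]
  congr 1
  funext x
  ring

/-- **Corollary: the first moment of the strain excess is nonnegative on every half-space**
`{x₂ > c}`: `0 ≤ ∫_{x₂>c} σ(x)(x₂ − c) dx`. -/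
theorem setIntegral_halfSpace_strainExcess_moment_nonneg (hu : ContDiff ℝ 2 u) (hdiv : VectorCalculus.IsDivFree u)
    (hC : 1 ≤ C) (h0 : ∀ x, ‖u x‖ ≤ C * (1 + ‖x‖) ^ (-(7 : ℝ)))
    (h1 : ∀ x, ‖fderiv ℝ u x‖ ≤ C * (1 + ‖x‖) ^ (-(7 : ℝ)))
    (h2 : ∀ x, ‖iteratedFDeriv ℝ 2 u x‖ ≤ C * (1 + ‖x‖) ^ (-(7 : ℝ))) (c : ℝ) :
    0 ≤ ∫ x in {x : EuclideanSpace ℝ (Fin 3) | c < x 2}, (∑ i : Fin 3, ∑ j : Fin 3,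
        fderiv ℝ u x (EuclideanSpace.single i 1) j * fderiv ℝ u x (EuclideanSpace.single j 1) i) * (x 2 - c) := by
  rw [← integral_plane_sq_apply_two_eq hu hdiv hC h0 h1 h2 c]
  exact integral_nonneg fun y => sq_nonneg _

end HalfSpace

/-! ### From rapid decay: the registered form -/

section Registered

/-- From `HasRapidSpatialDecay`: `‖Dⁿ w x‖ ≤ C (1 + ‖x‖)⁻⁷` with `C ≥ 0` (the defining bound with
`K = 7`, rewritten with a real power). -/
theorem norm_iteratedFDeriv_le_weight7 {F : Type*} [NormedAddCommGroup F] [NormedSpace ℝ F]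
    {w : EuclideanSpace ℝ (Fin 3) → F} (h : HasRapidSpatialDecay w) (n : ℕ) :
    ∃ C, 0 ≤ C ∧ ∀ x, ‖iteratedFDeriv ℝ n w x‖ ≤ C * (1 + ‖x‖) ^ (-(7 : ℝ)) := by
  obtain ⟨C, hC⟩ := h n 7
  refine ⟨max C 0, le_max_right _ _, fun x => ?_⟩
  have hx : 0 < (1 + ‖x‖) ^ (7 : ℕ) := by positivity
  have h1 : ‖iteratedFDeriv ℝ n w x‖ ≤ C / (1 + ‖x‖) ^ (7 : ℕ) := by
    rw [le_div_iff₀ hx, mul_comm]; exact hC x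
  have h2 : (1 + ‖x‖) ^ (-(7 : ℝ)) = ((1 + ‖x‖) ^ (7 : ℕ))⁻¹ := by
    rw [Real.rpow_neg (by positivity), show (7 : ℝ) = ((7 : ℕ) : ℝ) by norm_num, Real.rpow_natCast]
  rw [h2, ← div_eq_mul_inv]
  exact h1.trans (div_le_div_of_nonneg_right (le_max_left _ _) hx.le)

/-- **One decay constant (exponent 7).** From rapid decay of `u`: a single `C ≥ 1` with
`‖u‖, ‖Du‖, ‖D²u‖ ≤ C (1 + ‖x‖)⁻⁷` everywhere. -/
theorem exists_decay7_constant {u : EuclideanSpace ℝ (Fin 3) → EuclideanSpace ℝ (Fin 3)} (hdu : HasRapidSpatialDecay u) :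
    ∃ C, 1 ≤ C ∧ (∀ x, ‖u x‖ ≤ C * (1 + ‖x‖) ^ (-(7 : ℝ))) ∧
      (∀ x, ‖fderiv ℝ u x‖ ≤ C * (1 + ‖x‖) ^ (-(7 : ℝ))) ∧
      (∀ x, ‖iteratedFDeriv ℝ 2 u x‖ ≤ C * (1 + ‖x‖) ^ (-(7 : ℝ))) := by
  obtain ⟨C₀, h₀, hC₀⟩ := norm_iteratedFDeriv_le_weight7 hdu 0
  obtain ⟨C₁, h₁, hC₁⟩ := norm_iteratedFDeriv_le_weight7 hdu 1
  obtain ⟨C₂, h₂, hC₂⟩ := norm_iteratedFDeriv_le_weight7 hdu 2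
  refine ⟨1 + C₀ + C₁ + C₂, by linarith, fun x => ?_, fun x => ?_, fun x => ?_⟩
  · have := hC₀ x
    rw [norm_iteratedFDeriv_zero] at this
    exact this.trans (by gcongr; linarith)
  · have := hC₁ x
    rw [norm_iteratedFDeriv_one] at this
    exact this.trans (by gcongr; linarith)
  · exact (hC₂ x).trans (by gcongr; linarith)

/-- **`halfSpaceStrainExcessIdentity`, registered form** (sub-goal of stmt-NavierStokesRegularity-16855;
the idea card's `HalfSpaceStrainExcessIdentity` with its `let σ` unfolded): for a smooth, rapidly
decaying, divergence-free field `u` on `ℝ³` and every height `c`, the normal-jet planar energy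
equals the first moment of the strain excess `σ = Σᵢⱼ ∂ᵢuⱼ ∂ⱼuᵢ` (`= |S|² − ½|ω|² = −Δp`) over the
half-space beyond the plane: `∫_{x₂=c} u₂² dA = ∫_{x₂>c} σ(x)(x₂ − c) dx`. -/
theorem halfSpaceStrainExcessIdentity : ∀ (u : EuclideanSpace ℝ (Fin 3) → EuclideanSpace ℝ (Fin 3)), ContDiff ℝ (⊤ : ℕ∞) u → Literature.Analysis.FluidPDE.HasRapidSpatialDecay u → Literature.Analysis.FluidPDE.VectorCalculus.IsDivFree u → ∀ c : ℝ, (∫ y : EuclideanSpace ℝ (Fin 2), ((u (WithLp.toLp 2 ![y 0, y 1, c])) 2) ^ 2) = ∫ x in {x : EuclideanSpace ℝ (Fin 3) | c < x 2}, (∑ i : Fin 3, ∑ j : Fin 3, (fderiv ℝ u x (EuclideanSpace.single i 1)) j * (fderiv ℝ u x (EuclideanSpace.single j 1)) i) * (x 2 - c) := by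
  intro u hu hdec hdiv c
  obtain ⟨C, hC, h0, h1, h2⟩ := exists_decay7_constant hdec
  exact integral_plane_sq_apply_two_eq (hu.of_le (by norm_cast)) hdiv hC h0 h1 h2 c

end Registered

end Summit.NavierStokesRegularity.NavierStokesRegularity.Theorems.PlanarEnergyAPriori

end
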